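import Summits.CriticalPhenomena.PercolationContinuityZ3.Theorems.Transplant.SkelNegBParamsLF
import HarnessLib

/-!
# N1 params, chain of record `NegB` (box slot `g`; re-version of `SkelNeg1ParamsFineSize` p286366), part 3e (O-level): THE TRUE SIZE OF THE MULTIPLIERS OF RECORD — `m₀ − 1 ≥ 6R′ + 11` and `m₁ − 1 ≥ 14R′ + 27` from the actual long data (not only the floor
# `R′ ≤ m_i − 1`): `D = 640000·m > 640000·n(ℓ−1)`, `L̂₀ ≤ ℓ + 21n + 1`, `L̂₁ ≤ 11n` (shear bound `|h| ≤ 10n`), `n, ℓ ≥ M_L + 1`, `M_L ≥ 4K(R′+2)` — what the (C) Q-rooms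
# (`h5r₀`: `N·e ≤ 2r₀`-type) and the rounds bound `N ≈ 120` consume

builds on p205010 (kernel theorem, internal audit signed; external expert review pending) — nothing in this file uses p205010; NOTHING is claimed about
the node `SamePDropOfSkeletonNeg₁` (OPEN).
Status sentence (coordinator 2026-08-20T04:30Z): "θ(p_c) = 0 on ℤ^d, all d ≥ 2 — kernel-verified (Lean 4/Mathlib, standard axioms); internal adversarial
audit SIGNED 2026-08-20 04:29Z; external expert review pending."
Lane `prim-bschramm-*`, seat `prim-bschramm-stmt` (gen 13); helper file (`--supports stmt-CriticalPhenomena-4575 --as helper`); ledger HOME/prim-bschramm-stmt/NEG-PARAMS.md v0.9;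
HOME/prim-bschramm-stmt-g13/FEASIBILITY.md (the numbers these lemmas certify: `r₀ = K(m₀−1) ≳ 1.7·M_L`).
* §1 `mOf_floor_lt` (`D < 16000·K·L̂_i·(m_i + 1)`, both axes), `L0hat_le` (`L̂₀ ≤ ℓ + 21n + 1`), `L1hat_le` (`L̂₁ ≤ 11n`), `D_gt` (`640000·n·(ℓ−1) < D`);
* §2 **`true_size₀`** (`40·M_L ≤ 23·K·(s₀ + 2)`), **`true_size₁`** (`40·M_L ≤ 11·K·(s₁ + 2)`), **`s0_ge`** (`6R′ + 11 ≤ s₀`), **`s1_ge`** (`14R′ + 27 ≤ s₁`), `r0_ge`/`r1_ge`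
  (`K(6R′+11) ≤ r₀`, `K(14R′+27) ≤ r₁`).
[cite: MartineauTassion2017, §3.2 Lemma 3.5 (the equilibrium data), §4.3] [cite: KozmaNitzan2024, §4 pp. 25–26 (two-unit cells)]
-/

noncomputable section

open scoped Classical

namespace Summit.CriticalPhenomena.PercolationContinuityZ3.Theorems.Transplant

namespace PlanarSkeletonNeg

namespace NegB

open Literature.Probability.Percolation Literature.Probability.LatticeModels SimpleGraph
open SkelConc (Consts)
open Neg
open TwoAxis.Para (modulus)

section SizeLevel

variable (κ : Consts) {V : Type} [DecidableEq V] [Countable V] {G : SimpleGraph V} [G.LocallyFinite] (Φ : PlanarSkeletonNeg G) (t : V)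
  (p : unitInterval) (D : Skelφ.StepI.DataN V) (g f : ℕ)

/-! ## §1 The raw bounds -/

/-- **The floors of the multipliers from above**: `D < 16000·K·L̂₀·(m₀ + 1)` and `D < 16000·K·L̂₁·(m₁ + 1)` (definition of `⌊·⌋`). [folklore] -/
theorem mOf_floor_lt (hN : EqNumL κ Φ t p D g f) :
    Skelφ.NegPrm.Dof (nL κ Φ t p D g f) (hL κ Φ t p D g f) (ℓL κ Φ t p D g f) (vL κ Φ t p D g f) <
        (m0 κ Φ t p D g f + 1) * (20 * (Neg.K κ : ℤ) * (800 * Skelφ.NegPrm.L0hat (nL κ Φ t p D g f) (hL κ Φ t p D g f) (ℓL κ Φ t p D g f) (vL κ Φ t p D g f))) ∧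
      Skelφ.NegPrm.Dof (nL κ Φ t p D g f) (hL κ Φ t p D g f) (ℓL κ Φ t p D g f) (vL κ Φ t p D g f) <
        (m1 κ Φ t p D g f + 1) * (20 * (Neg.K κ : ℤ) * (800 * Skelφ.NegPrm.L1hat (nL κ Φ t p D g f) (hL κ Φ t p D g f))) := by
  obtain ⟨hn1, hℓ1⟩ := one_le_of_eqNumL κ Φ t p D g f hN
  have hK : (1 : ℤ) ≤ Neg.K κ := by exact_mod_cast (Neg.forty_le_K κ).2.2
  have hL0 : (1 : ℤ) ≤ Skelφ.NegPrm.L0hat (nL κ Φ t p D g f) (hL κ Φ t p D g f) (ℓL κ Φ t p D g f) (vL κ Φ t p D g f) := one_le_L0 hn1 hℓ1 _ _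
  have hL1 : (1 : ℤ) ≤ Skelφ.NegPrm.L1hat (nL κ Φ t p D g f) (hL κ Φ t p D g f) := by
    unfold Skelφ.NegPrm.L1hat
    have : (1 : ℤ) ≤ nL κ Φ t p D g f := by exact_mod_cast hn1
    linarith [abs_nonneg (hL κ Φ t p D g f)]
  have hb0 : (0 : ℤ) < 20 * (Neg.K κ : ℤ) * (800 * Skelφ.NegPrm.L0hat (nL κ Φ t p D g f) (hL κ Φ t p D g f) (ℓL κ Φ t p D g f) (vL κ Φ t p D g f)) := by positivity
  have hb1 : (0 : ℤ) < 20 * (Neg.K κ : ℤ) * (800 * Skelφ.NegPrm.L1hat (nL κ Φ t p D g f) (hL κ Φ t p D g f)) := by positivity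
  exact ⟨Int.lt_ediv_add_one_mul_self _ hb0, Int.lt_ediv_add_one_mul_self _ hb1⟩

/-- **`L̂₀ ≤ ℓ + 21n + 1`** (`|v_α| ≤ n`, `|v_β| ≤ ℓ + 2|h| + 1`, `|h| ≤ 10n`). [folklore] -/
theorem L0hat_le (hN : EqNumL κ Φ t p D g f) (hκ : (hL κ Φ t p D g f).natAbs ≤ 10 * nL κ Φ t p D g f) :
    Skelφ.NegPrm.L0hat (nL κ Φ t p D g f) (hL κ Φ t p D g f) (ℓL κ Φ t p D g f) (vL κ Φ t p D g f) ≤ (ℓL κ Φ t p D g f : ℤ) + 21 * nL κ Φ t p D g f + 1 := by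
  obtain ⟨hn1, -⟩ := one_le_of_eqNumL κ Φ t p D g f hN
  have hv := hN.v_le
  have hh : |hL κ Φ t p D g f| ≤ 10 * (nL κ Φ t p D g f : ℤ) := by
    rw [← Int.natCast_natAbs]; exact_mod_cast hκ
  have hvβ : |vβL κ Φ t p D g f| ≤ (ℓL κ Φ t p D g f : ℤ) + 2 * |hL κ Φ t p D g f| + 1 :=
    Skelφ.NegPrm.abs_vβ_le (by exact_mod_cast hn1) (by positivity) hv (Skelφ.NegPrm.modulus_vβOf_layer hn1 _ _ _)
  unfold Skelφ.NegPrm.L0hat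
  unfold vβL at hvβ
  linarith

/-- **`L̂₁ ≤ 11n`** (`|h| ≤ 10n`). [folklore] -/
theorem L1hat_le (hκ : (hL κ Φ t p D g f).natAbs ≤ 10 * nL κ Φ t p D g f) :
    Skelφ.NegPrm.L1hat (nL κ Φ t p D g f) (hL κ Φ t p D g f) ≤ 11 * (nL κ Φ t p D g f : ℤ) := by
  have hh : |hL κ Φ t p D g f| ≤ 10 * (nL κ Φ t p D g f : ℤ) := by
    rw [← Int.natCast_natAbs]; exact_mod_cast hκ
  unfold Skelφ.NegPrm.L1hat; linarith

/-- **`640000·n·(ℓ − 1) < D`** (`D = 800²·m`, `m > nℓ − n`). [folklore] -/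
theorem D_gt (hN : EqNumL κ Φ t p D g f) :
    640000 * ((nL κ Φ t p D g f : ℤ) * ((ℓL κ Φ t p D g f : ℤ) - 1)) < Skelφ.NegPrm.Dof (nL κ Φ t p D g f) (hL κ Φ t p D g f) (ℓL κ Φ t p D g f) (vL κ Φ t p D g f) := by
  obtain ⟨hn1, -⟩ := one_le_of_eqNumL κ Φ t p D g f hN
  have h1 := (Skelφ.NegPrm.modulus_vβOf hn1 (hL κ Φ t p D g f) (ℓL κ Φ t p D g f) (vL κ Φ t p D g f)).1
  unfold Skelφ.NegPrm.Dof TwoAxis.Para.detD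
  nlinarith

/-! ## §2 The true sizes -/

/-- **`40·M_L ≤ 23·K·(s₀ + 2)`**: the axis-0 unit `r₀ = K·s₀` is at least `(40/23)·M_L` up to `2K`. [this work] -/
theorem true_size₀ (hN : EqNumL κ Φ t p D g f) (hκ : (hL κ Φ t p D g f).natAbs ≤ 10 * nL κ Φ t p D g f) :
    40 * (ML κ Φ t p D g : ℤ) ≤ 23 * (Neg.K κ : ℤ) * ((((fcells κ Φ t p D g f).s 0 : ℕ) : ℤ) + 2) := by
  have hn := hN.n_le
  have hℓ := hN.ℓ_le
  have hlt := (mOf_floor_lt κ Φ t p D g f hN).1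
  have hLh := L0hat_le κ Φ t p D g f hN hκ
  have hDg := D_gt κ Φ t p D g f hN
  have hs : (((fcells κ Φ t p D g f).s 0 : ℕ) : ℤ) + 2 = m0 κ Φ t p D g f + 1 := by rw [(fcells_s_at κ Φ t p D g f hN).1]; unfold fm0; ring
  rw [hs]
  have hK : (0 : ℤ) ≤ Neg.K κ := by positivity
  have hm : (0 : ℤ) ≤ m0 κ Φ t p D g f + 1 := by linarith [(one_le_fm_at κ Φ t p D g f hN).1, show fm0 κ Φ t p D g f = m0 κ Φ t p D g f - 1 from rfl]
  set Mv : ℤ := (ML κ Φ t p D g : ℤ) with hMv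
  set n : ℤ := (nL κ Φ t p D g f : ℤ)
  set ℓ : ℤ := (ℓL κ Φ t p D g f : ℤ)
  set L : ℤ := Skelφ.NegPrm.L0hat (nL κ Φ t p D g f) (hL κ Φ t p D g f) (ℓL κ Φ t p D g f) (vL κ Φ t p D g f)
  set X : ℤ := (m0 κ Φ t p D g f + 1) * (Neg.K κ : ℤ) with hX
  -- `640000 n (ℓ−1) < D < 16000 K L (m₀+1)` ⇒ `40 n (ℓ−1) < K L (m₀+1) ≤ X (ℓ + 21 n + 1)`
  have h1 : 40 * (n * (ℓ - 1)) < X * L := by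
    have : (m0 κ Φ t p D g f + 1) * (20 * (Neg.K κ : ℤ) * (800 * L)) = 16000 * (X * L) := by rw [hX]; ring
    nlinarith
  have hX0 : 0 ≤ X := by rw [hX]; exact mul_nonneg hm hK
  have h2 : X * L ≤ X * (ℓ + 21 * n + 1) := mul_le_mul_of_nonneg_left hLh hX0
  -- with `n ≥ Mv + 1`, `ℓ ≥ Mv + 1`: `23 n (ℓ − 1) ≥ Mv (ℓ + 21 n + 1)` hence `40 Mv ≤ 23 X`
  have h3 : Mv * (ℓ + 21 * n + 1) ≤ 23 * (n * (ℓ - 1)) := by nlinarith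
  have hM0 : 0 ≤ Mv := by positivity
  by_contra hc
  push Not at hc
  -- `23 X < 40 Mv` ⇒ `23 X (ℓ+21n+1) < 40 Mv (ℓ+21n+1) ≤ 40·23 n(ℓ−1) < 23 X L ≤ 23 X (ℓ+21n+1)`: contradiction
  have hpos : 0 < ℓ + 21 * n + 1 := by linarith
  nlinarith [mul_lt_mul_of_pos_right hc hpos]

/-- **`40·M_L ≤ 11·K·(s₁ + 2)`**: the axis-1 unit `r₁ = K·s₁` is at least `(40/11)·M_L` up to `2K`. [this work] -/
theorem true_size₁ (hN : EqNumL κ Φ t p D g f) (hκ : (hL κ Φ t p D g f).natAbs ≤ 10 * nL κ Φ t p D g f) :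
    40 * (ML κ Φ t p D g : ℤ) ≤ 11 * (Neg.K κ : ℤ) * ((((fcells κ Φ t p D g f).s 1 : ℕ) : ℤ) + 2) := by
  have hn := hN.n_le
  have hℓ := hN.ℓ_le
  have hlt := (mOf_floor_lt κ Φ t p D g f hN).2
  have hLh := L1hat_le κ Φ t p D g f hκ
  have hDg := D_gt κ Φ t p D g f hN
  have hs : (((fcells κ Φ t p D g f).s 1 : ℕ) : ℤ) + 2 = m1 κ Φ t p D g f + 1 := by rw [(fcells_s_at κ Φ t p D g f hN).2]; unfold fm1; ring
  rw [hs]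
  have hK : (0 : ℤ) ≤ Neg.K κ := by positivity
  have hm : (0 : ℤ) ≤ m1 κ Φ t p D g f + 1 := by linarith [(one_le_fm_at κ Φ t p D g f hN).2, show fm1 κ Φ t p D g f = m1 κ Φ t p D g f - 1 from rfl]
  set Mv : ℤ := (ML κ Φ t p D g : ℤ)
  set n : ℤ := (nL κ Φ t p D g f : ℤ)
  set ℓ : ℤ := (ℓL κ Φ t p D g f : ℤ)
  set L : ℤ := Skelφ.NegPrm.L1hat (nL κ Φ t p D g f) (hL κ Φ t p D g f)
  set X : ℤ := (m1 κ Φ t p D g f + 1) * (Neg.K κ : ℤ) with hX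
  have h1 : 40 * (n * (ℓ - 1)) < X * L := by
    have : (m1 κ Φ t p D g f + 1) * (20 * (Neg.K κ : ℤ) * (800 * L)) = 16000 * (X * L) := by rw [hX]; ring
    nlinarith
  have hX0 : 0 ≤ X := by rw [hX]; exact mul_nonneg hm hK
  have h2 : X * L ≤ X * (11 * n) := mul_le_mul_of_nonneg_left hLh hX0
  -- `n ≥ Mv + 1`, `ℓ − 1 ≥ Mv`: `40 Mv n ≤ 40 n (ℓ−1) < 11 X n` ⇒ `40 Mv < 11 X`
  have hM0 : 0 ≤ Mv := by positivity
  have hn0 : 0 < n := by linarith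
  have h3 : 40 * (n * (ℓ - 1)) ≥ 40 * (n * Mv) := by nlinarith
  by_contra hc
  push Not at hc
  nlinarith [mul_lt_mul_of_pos_right hc hn0]

/-- `160·(R′+2) ≤ M_L / K`-type: `4K(R′+2) ≤ M_L` in `ℤ`. [folklore] -/
theorem coarse_floor_int : 4 * (Neg.K κ : ℤ) * ((R' κ Φ t p D : ℤ) + 2) ≤ (ML κ Φ t p D g : ℤ) := by
  have h := (coarse_floor_le_ML κ Φ t p D g).1
  exact_mod_cast h

/-- **`6R′ + 11 ≤ s₀ = m₀ − 1`** (true size of the axis-0 multiplier). [this work] -/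
theorem s0_ge (hN : EqNumL κ Φ t p D g f) (hκ : (hL κ Φ t p D g f).natAbs ≤ 10 * nL κ Φ t p D g f) :
    6 * (R' κ Φ t p D : ℤ) + 11 ≤ (((fcells κ Φ t p D g f).s 0 : ℕ) : ℤ) := by
  have h1 := true_size₀ κ Φ t p D g f hN hκ
  have h2 := coarse_floor_int κ Φ t p D g
  have hK : (1 : ℤ) ≤ Neg.K κ := by exact_mod_cast (Neg.forty_le_K κ).2.2
  have hR : (0 : ℤ) ≤ R' κ Φ t p D := by positivity
  -- `160 K (R′+2) ≤ 40 M_L ≤ 23 K (s₀+2)` ⇒ `160(R′+2) ≤ 23(s₀+2)`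
  have h3 : (Neg.K κ : ℤ) * (160 * ((R' κ Φ t p D : ℤ) + 2)) ≤ (Neg.K κ : ℤ) * (23 * ((((fcells κ Φ t p D g f).s 0 : ℕ) : ℤ) + 2)) := by nlinarith
  have h4 := le_of_mul_le_mul_left h3 (by linarith)
  linarith

/-- **`14R′ + 27 ≤ s₁ = m₁ − 1`** (true size of the axis-1 multiplier). [this work] -/
theorem s1_ge (hN : EqNumL κ Φ t p D g f) (hκ : (hL κ Φ t p D g f).natAbs ≤ 10 * nL κ Φ t p D g f) :
    14 * (R' κ Φ t p D : ℤ) + 27 ≤ (((fcells κ Φ t p D g f).s 1 : ℕ) : ℤ) := by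
  have h1 := true_size₁ κ Φ t p D g f hN hκ
  have h2 := coarse_floor_int κ Φ t p D g
  have hK : (1 : ℤ) ≤ Neg.K κ := by exact_mod_cast (Neg.forty_le_K κ).2.2
  have hR : (0 : ℤ) ≤ R' κ Φ t p D := by positivity
  have h3 : (Neg.K κ : ℤ) * (160 * ((R' κ Φ t p D : ℤ) + 2)) ≤ (Neg.K κ : ℤ) * (11 * ((((fcells κ Φ t p D g f).s 1 : ℕ) : ℤ) + 2)) := by nlinarith
  have h4 := le_of_mul_le_mul_left h3 (by linarith)
  linarith

/-- **The units of record are large**: `K·(6R′+11) ≤ r₀` and `K·(14R′+27) ≤ r₁` (`r_i = K·s_i`). [this work] -/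
theorem r_ge (hN : EqNumL κ Φ t p D g f) (hκ : (hL κ Φ t p D g f).natAbs ≤ 10 * nL κ Φ t p D g f) :
    (Neg.K κ : ℤ) * (6 * (R' κ Φ t p D : ℤ) + 11) ≤ ((fcells κ Φ t p D g f).r 0 : ℤ) ∧
      (Neg.K κ : ℤ) * (14 * (R' κ Φ t p D : ℤ) + 27) ≤ ((fcells κ Φ t p D g f).r 1 : ℤ) := by
  have h0 := s0_ge κ Φ t p D g f hN hκ
  have h1 := s1_ge κ Φ t p D g f hN hκ
  have hK : (0 : ℤ) ≤ Neg.K κ := by positivity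
  rw [(fcells κ Φ t p D g f).r_eq 0, (fcells κ Φ t p D g f).r_eq 1, (fcells_K κ Φ t p D g f).1]
  exact ⟨mul_le_mul_of_nonneg_left h0 hK, mul_le_mul_of_nonneg_left h1 hK⟩

end SizeLevel

end NegB

end PlanarSkeletonNeg

end Summit.CriticalPhenomena.PercolationContinuityZ3.Theorems.Transplant

end
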